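import Summits.CriticalPhenomena.PercolationContinuityZ3.Theorems.PercNearOneGluingNoHeavyLowerTailBlockQ9DynCert
import Summits.CriticalPhenomena.PercolationContinuityZ3.Theorems.PercNearOneGluingNoHeavyLowerTailBlockQ9DynSteps
import HarnessLib

/-!
# `NoHeavyLowerTail` (stmt-CriticalPhenomena-4575) — the REDUCTION THEOREM of the dynamic-anchor line:
# a one-step local statement at every block state implies Kozma–Nitzan's (41) for the K-minimiser, hence Question 9

Support file (lemma factory `prim-lf-1` gen 9; `--supports stmt-CriticalPhenomena-4575`).  No new analytic content: bookkeeping over the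
landed certificate calculus (`BlockQ9.DynCert`, `blockQ9_of_reliableBlock`, `blockThm4_general`, `T_branch` via the `grow`/`up`/`switch`
constructors).  Memo FROM-prim-lf-1-gen9.md §6, HOME/EC-NOTE.md §13.

State `(u, O, a)`: weights `u`, glued block `O` (disjoint from `A`, `b ∉ O`), anchor `a ∈ A ∖ {b}`.  `K`-weights := `kill_O u` (pairs meeting
`O` get weight `0`); `a` is a K-MINIMISER if `μ_K(a ↔ b) ≤ μ_K(a' ↔ b)` for every `a' ∈ A ∖ {b}` (`IsKMin`).  The LOCAL STEP (`LocalStep A b`) says: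
at every such state where neither the reliable-block leaf (L3) nor the Theorem-4 leaf (T4) applies, some live pair `s(s₀,v)` has an
admissible open side — `v = b`; or `v ∈ A` with the up-set comparison (UP) or L3 after absorbing `v`; or `v ∉ A` with `a` still a
minimiser for the grown block, or a transfer to a minimiser `a'` of the grown block, or any `DynCert` for the grown block.  Closed
children keep the block and its K-weights, hence the K-minimiser: they are covered by the induction itself.

* `q9block_of_localStep` — `LocalStep A b` ⇒ for every block state and every K-minimiser `a`: `μ_{glue_O u}(a ↔ b, O ↔ A) ≤ μ_{glue_O u}(O ↔ b)`
  (strong induction on the number of undecided pairs).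
* `q9_of_localStep` — the root form: `LocalStep A b` ⇒ (41) at every observer `o ∉ A` for every minimiser of `μ_{G−o}(· ↔ b)`
  (Kozma–Nitzan's Question-9 relay).
[cite: KozmaNitzan2024, Question 9 (p. 36), Theorem 4 (p. 12)]
-/

namespace Summit.CriticalPhenomena.PercolationContinuityZ3.Theorems

open MeasureTheory Set ProbabilityTheory
open Literature.Probability.LatticeModels
open Literature.Probability.Percolation

noncomputable section
open Classical

namespace BlockQ9

variable {n : ℕ}

/-- `a` is a K-minimiser at the block state `(u, O)`: among the relays other than `b`, `a` is least connected to `b` once the block is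
deleted (`kill_O u`). [cite: KozmaNitzan2024, Question 9 (p. 36)] -/
def IsKMin (A : Finset (Fin n)) (b : Fin n) (u : Sym2 (Fin n) → unitInterval) (O : Finset (Fin n)) (a : Fin n) : Prop :=
  a ∈ A ∧ a ≠ b ∧ ∀ a' ∈ A, a' ≠ b →
    (prodBernoulli (fun e : Sym2 (Fin n) => if (∃ x ∈ e, x ∈ O) then 0 else u e)).real (openConn a b) ≤
      (prodBernoulli (fun e : Sym2 (Fin n) => if (∃ x ∈ e, x ∈ O) then 0 else u e)).real (openConn a' b)

/-- The target inequality (41) for the glued block state `(u, O, a)`. [cite: KozmaNitzan2024, (41) p. 36] -/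
def Holds41 (A : Finset (Fin n)) (b : Fin n) (u : Sym2 (Fin n) → unitInterval) (O : Finset (Fin n)) (a : Fin n) : Prop :=
  (prodBernoulli (fun d : Sym2 (Fin n) => if (∀ x ∈ d, x ∈ O) ∧ ¬ d.IsDiag then 1 else u d)).real
      (openConn a b ∩ ⋃ o ∈ O, ⋃ x ∈ A, openConn o x) ≤
    (prodBernoulli (fun d : Sym2 (Fin n) => if (∀ x ∈ d, x ∈ O) ∧ ¬ d.IsDiag then 1 else u d)).real
      (⋃ o ∈ O, openConn o b)

/-- The ONE-STEP LOCAL STATEMENT of the dynamic-anchor line (memo §6 (B2), with `DynCert` in place of the growth-free peeling), used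
ONLY AS A HYPOTHESIS SCHEMA of the reduction theorems below (it is this unit's conjecture DQ9, censused 0 / 1.7 M states; it is NOT asserted):
at every block state with a K-minimiser anchor where the leaves L3 and T4 fail, some live pair has an admissible open side.
[cite: KozmaNitzan2024, Question 9 (p. 36)] -/
def LocalStep (A : Finset (Fin n)) (b : Fin n) : Prop :=
  ∀ (u : Sym2 (Fin n) → unitInterval) (O : Finset (Fin n)) (a : Fin n),
    Disjoint O A → b ∉ O → O.Nonempty → IsKMin A b u O a →
    -- ¬ L3
    ¬ (∃ o₀ ∈ O, (prodBernoulli (fun e : Sym2 (Fin n) => if (∀ x ∈ e, x ∈ O) ∧ ¬ e.IsDiag then 1 else u e)).real (openConn a b) ≤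
        (prodBernoulli (fun e : Sym2 (Fin n) => if (∀ x ∈ e, x ∈ O) ∧ ¬ e.IsDiag then 1 else u e)).real (openConn o₀ b)) →
    -- ¬ T4
    ¬ (∀ v : Fin n, v ∉ O → (∃ o ∈ O, u s(o, v) ≠ 0) →
        (prodBernoulli (fun e : Sym2 (Fin n) => if (∃ x ∈ e, x ∈ O) then 0 else u e)).real (openConn a b) ≤
          (prodBernoulli (fun e : Sym2 (Fin n) => if (∃ x ∈ e, x ∈ O) then 0 else u e)).real (openConn v b)) →
    ∃ s₀ ∈ O, ∃ v : Fin n, v ∉ O ∧ u s(s₀, v) ≠ 0 ∧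
      ( v = b ∨
        (v ∈ A ∧ ((prodBernoulli (fun d : Sym2 (Fin n) => if (∀ x ∈ d, x ∈ O) ∧ ¬ d.IsDiag then 0 else u d)).real (openConn a b) ≤
                    (prodBernoulli (fun d : Sym2 (Fin n) => if (∀ x ∈ d, x ∈ O) ∧ ¬ d.IsDiag then 0 else u d)).real (openConn v b)
                  ∨ (prodBernoulli (fun e : Sym2 (Fin n) => if (∀ x ∈ e, x ∈ insert v O) ∧ ¬ e.IsDiag then 1 else u e)).real (openConn a b) ≤
                    (prodBernoulli (fun e : Sym2 (Fin n) => if (∀ x ∈ e, x ∈ insert v O) ∧ ¬ e.IsDiag then 1 else u e)).real (openConn v b))) ∨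
        (v ∉ A ∧ (IsKMin A b u (insert v O) a
                  ∨ (∃ a' : Fin n, IsKMin A b u (insert v O) a' ∧
                      (prodBernoulli (fun d : Sym2 (Fin n) => if (∀ x ∈ d, x ∈ insert v O) ∧ ¬ d.IsDiag then 1 else u d)).real
                          (openConn a b ∩ ⋃ o ∈ insert v O, ⋃ x ∈ A, openConn o x) ≤
                        (prodBernoulli (fun d : Sym2 (Fin n) => if (∀ x ∈ d, x ∈ insert v O) ∧ ¬ d.IsDiag then 1 else u d)).real
                          (openConn a' b ∩ ⋃ o ∈ insert v O, ⋃ x ∈ A, openConn o x))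
                  ∨ DynCert A b u (insert v O) a)) )

/-- The undecided pairs of a state: non-diagonal pairs not inside the block with positive weight (the induction measure). -/
def undecided (u : Sym2 (Fin n) → unitInterval) (O : Finset (Fin n)) : Finset (Sym2 (Fin n)) :=
  Finset.univ.filter fun d => ¬ d.IsDiag ∧ ¬ (∀ x ∈ d, x ∈ O) ∧ u d ≠ 0

/-- Membership in the undecided pairs. -/
theorem mem_undecided {u : Sym2 (Fin n) → unitInterval} {O : Finset (Fin n)} {d : Sym2 (Fin n)} :
    d ∈ undecided u O ↔ ¬ d.IsDiag ∧ ¬ (∀ x ∈ d, x ∈ O) ∧ u d ≠ 0 := by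
  simp only [undecided, Finset.mem_filter, Finset.mem_univ, true_and]

/-- The branching pair is undecided. -/
theorem pair_mem_undecided (u : Sym2 (Fin n) → unitInterval) (O : Finset (Fin n)) (s₀ v : Fin n)
    (hs₀ : s₀ ∈ O) (hv : v ∉ O) (hne : u s(s₀, v) ≠ 0) : s(s₀, v) ∈ undecided u O := by
  rw [mem_undecided]
  refine ⟨?_, fun h => hv (h v (Sym2.mem_mk_right s₀ v)), hne⟩
  rw [Sym2.mk_isDiag_iff]
  exact fun h => hv (h ▸ hs₀)

/-- Closing the branching pair strictly decreases the undecided pairs. -/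
theorem undecided_close_ssubset (u : Sym2 (Fin n) → unitInterval) (O : Finset (Fin n)) (s₀ v : Fin n)
    (hs₀ : s₀ ∈ O) (hv : v ∉ O) (hne : u s(s₀, v) ≠ 0) :
    undecided (fun d : Sym2 (Fin n) => if d = s(s₀, v) then 0 else u d) O ⊂ undecided u O := by
  have hsub : undecided (fun d : Sym2 (Fin n) => if d = s(s₀, v) then 0 else u d) O ⊆ undecided u O := by
    intro d hd
    rw [mem_undecided] at hd ⊢
    refine ⟨hd.1, hd.2.1, ?_⟩
    have h3 := hd.2.2
    by_cases hde : d = s(s₀, v)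
    · exact absurd (by simp only [hde, if_true]) h3
    · simpa only [if_neg hde] using h3
  refine (Finset.ssubset_iff_of_subset hsub).2 ⟨s(s₀, v), pair_mem_undecided u O s₀ v hs₀ hv hne, ?_⟩
  rw [mem_undecided]
  simp only [if_true, ne_eq, not_true_eq_false, and_false, not_false_eq_true]

/-- Growing the block through the branching pair strictly decreases the undecided pairs. -/
theorem undecided_grow_ssubset (u : Sym2 (Fin n) → unitInterval) (O : Finset (Fin n)) (s₀ v : Fin n)
    (hs₀ : s₀ ∈ O) (hv : v ∉ O) (hne : u s(s₀, v) ≠ 0) :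
    undecided u (insert v O) ⊂ undecided u O := by
  have hsub : undecided u (insert v O) ⊆ undecided u O := by
    intro d hd
    rw [mem_undecided] at hd ⊢
    exact ⟨hd.1, fun h => hd.2.1 fun x hx => Finset.mem_insert_of_mem (h x hx), hd.2.2⟩
  refine (Finset.ssubset_iff_of_subset hsub).2 ⟨s(s₀, v), pair_mem_undecided u O s₀ v hs₀ hv hne, ?_⟩
  rw [mem_undecided]
  simp only [not_and, not_not]
  intro _ h
  exact absurd (fun x hx => by
    rcases Sym2.mem_iff.1 hx with rfl | rfl
    · exact Finset.mem_insert_of_mem hs₀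
    · exact Finset.mem_insert_self _ O) h

/-- Closing a pair that meets the block does not change the block-deleted weights. -/
theorem kill_close_eq (u : Sym2 (Fin n) → unitInterval) (O : Finset (Fin n)) (s₀ v : Fin n) (hs₀ : s₀ ∈ O) :
    (fun e : Sym2 (Fin n) => if (∃ x ∈ e, x ∈ O) then (0 : unitInterval) else (if e = s(s₀, v) then 0 else u e)) =
      fun e : Sym2 (Fin n) => if (∃ x ∈ e, x ∈ O) then 0 else u e := by
  funext e
  by_cases h : ∃ x ∈ e, x ∈ O
  · simp only [if_pos h]
  · have hne : e ≠ s(s₀, v) := fun he => h ⟨s₀, he ▸ Sym2.mem_mk_left s₀ v, hs₀⟩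
    simp only [if_neg h, if_neg hne]

/-- Closing a pair that meets the block preserves the K-minimiser. -/
theorem isKMin_close (A : Finset (Fin n)) (b : Fin n) (u : Sym2 (Fin n) → unitInterval) (O : Finset (Fin n)) (a s₀ v : Fin n)
    (hs₀ : s₀ ∈ O) (h : IsKMin A b u O a) :
    IsKMin A b (fun d : Sym2 (Fin n) => if d = s(s₀, v) then 0 else u d) O a := by
  refine ⟨h.1, h.2.1, fun a' ha' hne => ?_⟩
  have := h.2.2 a' ha' hne
  rw [kill_close_eq u O s₀ v hs₀]
  exact this

/-- **Reduction theorem (block form).**  If the local step holds at every state, then (41) holds at every block state for every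
K-minimiser anchor. [cite: KozmaNitzan2024, Question 9 (p. 36)] -/
theorem q9block_of_localStep (A : Finset (Fin n)) (b : Fin n) (hb : b ∈ A) (hstep : LocalStep A b) :
    ∀ (m : ℕ) (u : Sym2 (Fin n) → unitInterval) (O : Finset (Fin n)) (a : Fin n),
      (undecided u O).card = m → Disjoint O A → O.Nonempty → IsKMin A b u O a → Holds41 A b u O a := by
  intro m
  induction m using Nat.strong_induction_on with
  | _ m IH =>
  intro u O a hm hOA hOne hmin
  have haA : a ∈ A := hmin.1
  have haO : a ∉ O := fun h => Finset.disjoint_left.1 hOA h haA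
  have hbO : b ∉ O := fun h => Finset.disjoint_left.1 hOA h hb
  -- leaves
  by_cases hL3 : ∃ o₀ ∈ O, (prodBernoulli (fun e : Sym2 (Fin n) => if (∀ x ∈ e, x ∈ O) ∧ ¬ e.IsDiag then 1 else u e)).real (openConn a b) ≤
        (prodBernoulli (fun e : Sym2 (Fin n) => if (∀ x ∈ e, x ∈ O) ∧ ¬ e.IsDiag then 1 else u e)).real (openConn o₀ b)
  · obtain ⟨o₀, ho₀, hle⟩ := hL3
    exact (DynCert.l3 o₀ ho₀ hle : DynCert A b u O a).sound
  by_cases hT4 : ∀ v : Fin n, v ∉ O → (∃ o ∈ O, u s(o, v) ≠ 0) →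
        (prodBernoulli (fun e : Sym2 (Fin n) => if (∃ x ∈ e, x ∈ O) then 0 else u e)).real (openConn a b) ≤
          (prodBernoulli (fun e : Sym2 (Fin n) => if (∃ x ∈ e, x ∈ O) then 0 else u e)).real (openConn v b)
  · exact (DynCert.t4 hOA haO hbO hT4 : DynCert A b u O a).sound
  -- the local step
  obtain ⟨s₀, hs₀, v, hv, hne, hopts⟩ := hstep u O a hOA hbO hOne hmin hL3 hT4
  -- closed child: same block, same K-weights, fewer undecided pairs
  have hclosed : Holds41 A b (fun d : Sym2 (Fin n) => if d = s(s₀, v) then 0 else u d) O a :=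
    IH _ (hm ▸ Finset.card_lt_card (undecided_close_ssubset u O s₀ v hs₀ hv hne)) _ O a rfl hOA hOne
      (isKMin_close A b u O a s₀ v hs₀ hmin)
  rcases hopts with hvb | ⟨hvA, hrel⟩ | ⟨hvA, hst⟩
  · -- door to `b`: the grown block contains `b`
    have hbin : b ∈ insert v O := by rw [← hvb]; exact Finset.mem_insert_self v O
    exact blockQ9_grow u O A a b s₀ v hs₀ hv (DynCert.bin hbin : DynCert A b u (insert v O) a).sound hclosed
  · rcases hrel with hup | hl3
    · exact blockQ9_up u O A a b s₀ v hs₀ hv hup hclosed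
    · exact blockQ9_grow u O A a b s₀ v hs₀ hv
        (DynCert.l3 v (Finset.mem_insert_self v O) hl3 : DynCert A b u (insert v O) a).sound hclosed
  · -- Steiner door: the grown block is again a relay-free block state with fewer undecided pairs
    have hOA' : Disjoint (insert v O) A := by
      rw [Finset.disjoint_insert_left]; exact ⟨hvA, hOA⟩
    have hlt : (undecided u (insert v O)).card < m :=
      hm ▸ Finset.card_lt_card (undecided_grow_ssubset u O s₀ v hs₀ hv hne)
    have hopen : Holds41 A b u (insert v O) a := by
      rcases hst with hsame | ⟨a', hmin', htr⟩ | hcert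
      · exact IH _ hlt u (insert v O) a rfl hOA' (Finset.insert_nonempty v O) hsame
      · exact htr.trans (IH _ hlt u (insert v O) a' rfl hOA' (Finset.insert_nonempty v O) hmin')
      · exact hcert.sound
    exact blockQ9_grow u O A a b s₀ v hs₀ hv hopen hclosed

/-- **Reduction theorem (root form): the local step implies Kozma–Nitzan's (41) at every observer for every Question-9 relay.**
If `LocalStep A b` holds, then for every `o ∉ A` and every relay `a ≠ b` minimising `μ_{G−o}(· ↔ b)`:
`μ_u(a ↔ b, o ↔ A) ≤ μ_u(o ↔ b)`. [cite: KozmaNitzan2024, Question 9 (p. 36)] -/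
theorem q9_of_localStep (A : Finset (Fin n)) (b : Fin n) (hb : b ∈ A) (hstep : LocalStep A b)
    (u : Sym2 (Fin n) → unitInterval) (o a : Fin n) (hoA : o ∉ A)
    (hmin : IsKMin A b u {o} a) :
    (prodBernoulli u).real (openConn a b ∩ ⋃ x ∈ A, openConn o x) ≤ (prodBernoulli u).real (openConn o b) := by
  have h := q9block_of_localStep A b hb hstep _ u {o} a rfl (Finset.disjoint_singleton_left.2 hoA)
    (Finset.singleton_nonempty o) hmin
  unfold Holds41 at h
  rw [goodStep24_glue_singleton] at h
  simpa only [Finset.mem_singleton, iUnion_iUnion_eq_left] using h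

end BlockQ9

end

end Summit.CriticalPhenomena.PercolationContinuityZ3.Theorems
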